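import Summits.BirchSwinnertonDyer.BirchSwinnertonDyer.Theses.ShaPrimaryTransfer
import Literature.NumberTheory.EllipticCurves.XCubeAddDXSharpRankSha
import Literature.NumberTheory.EllipticCurves.XCubeSub82XRankThree

/-!
# BirchSwinnertonDyer / ShaPrimaryTransfer — crux `FiniteShaComponentTransfer` (stmt-BirchSwinnertonDyer-22356):
# the door at 2 is open in the kernel at RANK 4 — `E : y² = x³ − 6497x` (`6497 = 73·89`) has `rank E(ℚ) = 4` and `Ш(E/ℚ)[2] = 0`

Route `ShaPrimaryTransfer` (D-0145 LINE 2): T = `FiniteShaComponentTransfer` (stmt-22356), whose door at `2` is decided curve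
by curve by complete `2`-descent; companions certify the door in the kernel at ranks `0–3`, `5`, `6`, `7`. This helper file
(prover seat `bsd-line-spt-p1` g5, `--supports stmt-22356 --as helper`) fills in RANK 4: `E : y² = x³ − 6497x`,
`6497 = 73·89` (the two primes of Silverman's Remark X.6.4), `E' : y² = x³ + 25988x`. The descent via `2`-isogeny is SHARP:
on `E` the points `(−16, 316)`, `(89, 356)`, `(−73, 292)` give `α = [−1], [89], [−73]` (six classes with `[1]`, `[73]`, `[−89]`);
on `E'` the points `(2, 228)`, `(146, 2628)`, `(178, 3204)` give `ᾱ = [2], [146], [178]` (five classes with `[1]`, `[73]`). Since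
`#α · #ᾱ = 2^{rank+2}` (Silverman–Tate, tree `natCard_range_xSqClass_mul`) both are powers of `2`, so `#α, #ᾱ ≥ 8` and
`2^{rank+2} ≥ 2⁶`; with `rank ≤ ν(6497) + ν(12994) − 1 = 4` (X.6.1(b) sharpened, tree `XCubeAddDX.mordellWeilRank_le_add`):
**`rank E(ℚ) = 4`** (`mordellWeilRank_eq_four`), and the bound being attained **`Ш(E/ℚ)[2] = 0`** (tree
`forall_mem_sha_two_smul_eq_zero_xD_of_rank_eq`, X.4.7), `t_2(E) = 0` (`door_at_two_rank_four`), `corank Sel_{2^∞}(E) = 4`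
(`selmerCorank_two_eq_four`), O for `E`; T BY NAME: `selmerCorank_eq_four_of_transfer`. Everything UNCONDITIONAL (standard
axioms, no named fact). Nothing here proves T, O or BSD; T is conjecture-grade at rank ≥ 2. (`E` has CM by `ℤ[i]`.)
References: J. H. Silverman, *AEC* 2nd ed., X.4.7, X.4.9, X.6.1, Remark X.6.4; J. H. Silverman, J. Tate, *Rational Points on
Elliptic Curves*, §3.5–3.6; R. Greenberg, LNM 1716 (1999), §1.
-/

-- D-0017: single-problem summit, so `Summit.BirchSwinnertonDyer.BirchSwinnertonDyer.…` repeats a namespace BY DESIGN.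
set_option linter.dupNamespace false

noncomputable section

namespace Summit.BirchSwinnertonDyer.BirchSwinnertonDyer.Theorems.ShaPrimaryTransferKernelRankFour

open scoped Classical
open Literature.NumberTheory.EllipticCurves Literature.NumberTheory.EllipticCurves.XCubeAddDX
open WeierstrassCurve WeierstrassCurve.Affine
open Summit.BirchSwinnertonDyer.BirchSwinnertonDyer.Theses.ShaPrimaryTransfer (FiniteShaComponentTransfer)

/-! ## §0 Bookkeeping (`n = 6497 = 73·89`, `4n = 25988`) -/

/-- `b(a² − 4b) ≠ 0` for `(a, b) = (0, −6497)`. [folklore] -/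
private theorem hab4 : (-6497 : ℤ) * ((0 : ℤ) ^ 2 - 4 * (-6497)) ≠ 0 := by norm_num

/-- The tree's literal `E_{0,−6497}` is `⟨0, 0, 0, −6497, 0⟩`. [folklore] -/
private theorem lit_E : (⟨0, ((0 : ℤ) : ℚ), 0, ((-6497 : ℤ) : ℚ), 0⟩ : WeierstrassCurve ℚ) = ⟨0, 0, 0, -6497, 0⟩ := by
  ext <;> push_cast <;> ring

/-- The literal `⟨0, 0, 0, ((−6497 : ℤ) : ℚ), 0⟩` is `⟨0, 0, 0, −6497, 0⟩`. [folklore] -/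
private theorem lit_E₀ : (⟨0, 0, 0, ((-6497 : ℤ) : ℚ), 0⟩ : WeierstrassCurve ℚ) = ⟨0, 0, 0, -6497, 0⟩ := by
  ext <;> push_cast <;> ring

/-- The tree's literal `E'_{0,−6497} = E_{0, 25988}` is `⟨0, 0, 0, 25988, 0⟩`. [folklore] -/
private theorem lit_E' :
    (⟨0, ((-2 * 0 : ℤ) : ℚ), 0, (((0 : ℤ) ^ 2 - 4 * (-6497) : ℤ) : ℚ), 0⟩ : WeierstrassCurve ℚ) = ⟨0, 0, 0, 25988, 0⟩ := by
  ext <;> push_cast <;> ring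

/-- `E : y² = x³ − 6497x` is an elliptic curve. [folklore] -/
theorem isElliptic_E : (⟨0, 0, 0, -6497, 0⟩ : WeierstrassCurve ℚ).IsElliptic := by
  rw [← lit_E]; exact isElliptic_mk_of_ne_zero (F := ℚ) hab4

/-- `E' : y² = x³ + 25988x` is an elliptic curve. [folklore] -/
theorem isElliptic_E' : (⟨0, 0, 0, 25988, 0⟩ : WeierstrassCurve ℚ).IsElliptic := by
  rw [← lit_E']; exact isElliptic_mk_of_ne_zero (F := ℚ) (twoIsogenyCodomain_ne_zero hab4)

/-- Squarefree integers with the same class in `ℚ*/ℚ*²` are equal. [folklore] -/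
private theorem eq_of_sqClass_intCast_eq {d₁ d₂ : ℤ} (h₁ : Squarefree d₁) (h₂ : Squarefree d₂)
    (he : sqClass (d₁ : ℚ) = sqClass (d₂ : ℚ)) : d₁ = d₂ := by
  have h0₁ : (d₁ : ℚ) ≠ 0 := by exact_mod_cast h₁.ne_zero
  have h0₂ : (d₂ : ℚ) ≠ 0 := by exact_mod_cast h₂.ne_zero
  have h1 : sqClass ((d₁ : ℚ) * d₂) = 1 := by rw [sqClass_mul h0₁ h0₂, he, SqUnits.mul_self]
  obtain ⟨u, hu⟩ := (sqClass_eq_one_iff (mul_ne_zero h0₁ h0₂)).mp h1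
  obtain ⟨m, hm⟩ : IsSquare (d₁ * d₂) := by
    rw [← Rat.isSquare_intCast_iff]
    exact ⟨u, by push_cast; rw [hu, pow_two]⟩
  exact eq_of_squarefree_of_mul_eq_sq h₁ h₂ (m := m) (by rw [hm, pow_two])

/-- Squarefreeness of an integer from the factorisation of its absolute value. [folklore] -/
private theorem squarefree_int_of_natAbs {d : ℤ} {n : ℕ} (h : d.natAbs = n) (hn : n ≠ 0)
    (hnd : n.primeFactorsList.Nodup) : Squarefree d :=
  Int.squarefree_natAbs.mp (h ▸ (Nat.squarefree_iff_nodup_primeFactorsList hn).mpr hnd)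

/-- A rational solution of `y² = x³ + bx` with `x ≠ 0` puts `[x]` into `α(E_{0,b}(ℚ))`. [folklore] -/
private theorem sqClass_mem_range_of_eq {b x y : ℚ} [(⟨0, 0, 0, b, 0⟩ : WeierstrassCurve ℚ).IsElliptic]
    (hy : y ^ 2 = x ^ 3 + b * x) (hx : x ≠ 0) : sqClass x ∈ Set.range (⟨0, 0, 0, b, 0⟩ : WeierstrassCurve ℚ).xSqClass := by
  have hns : (⟨0, 0, 0, b, 0⟩ : WeierstrassCurve ℚ).toAffine.Nonsingular x y := by
    refine Affine.equation_iff_nonsingular.mp ?_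
    rw [Affine.equation_iff]
    show y ^ 2 + 0 * x * y + 0 * y = x ^ 3 + 0 * x ^ 2 + b * x + 0
    linear_combination hy
  exact ⟨.some x y hns, xSqClass_some_of_ne_zero _ hx⟩

/-- `[x t²] = [x]` in `ℚ*/ℚ*²`. [folklore] -/
private theorem sqClass_mul_sq' {x t : ℚ} (hx : x ≠ 0) (ht : t ≠ 0) : sqClass (x * t ^ 2) = sqClass x := by
  rw [sqClass_mul hx (pow_ne_zero 2 ht), sqClass_sq, mul_one]

/-- A power of `2` exceeding `4` is at least `8`. [folklore] -/
private theorem eight_le_of_pow {m j : ℕ} (hm : m = 2 ^ j) (hlt : 4 < m) : 8 ≤ m := by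
  subst hm
  have hj : 2 < j := (Nat.pow_lt_pow_iff_right Nat.one_lt_two).mp (by simpa using hlt)
  exact le_trans (by norm_num) (Nat.pow_le_pow_right two_pos hj)

/-! ## §1 `#α(E(ℚ)) ≥ 6` and `#ᾱ(E'(ℚ)) ≥ 5` from six rational points -/

/-- **`#α(E(ℚ)) ≥ 6` for `E : y² = x³ − 6497x`**: the points `(−16, 316)`, `(89, 356)`, `(−73, 292)` give `α = [−1], [89], [−73]`,
whence also `[73]`, `[−89]` and `[1]`. UNCONDITIONAL. [cite: SilvermanTate2015, §3.5–3.6 (α(x,y) = x mod ℚ*²)] -/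
theorem natCard_range_xSqClass_E_ge :
    (Set.range (⟨0, 0, 0, -6497, 0⟩ : WeierstrassCurve ℚ).xSqClass).Finite ∧
      6 ≤ Nat.card (Set.range (⟨0, 0, 0, -6497, 0⟩ : WeierstrassCurve ℚ).xSqClass) := by
  haveI := isElliptic_E
  set W := (⟨0, 0, 0, -6497, 0⟩ : WeierstrassCurve ℚ) with hW
  have hfin : (Set.range W.xSqClass).Finite := by
    have h := (natCard_range_xSqClass_le (a := 0) (b := -6497) hab4).1
    rw [lit_E] at h
    exact h
  refine ⟨hfin, ?_⟩
  have mul : ∀ {x y : ℚ}, x ≠ 0 → y ≠ 0 → sqClass x ∈ Set.range W.xSqClass → sqClass y ∈ Set.range W.xSqClass →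
      sqClass (x * y) ∈ Set.range W.xSqClass := by
    intro x y hx hy h₁ h₂
    rw [sqClass_mul hx hy]
    exact mul_mem_range_xSqClass W h₁ h₂
  have g0 : sqClass (1 : ℚ) ∈ Set.range W.xSqClass :=
    ⟨0, by rw [xSqClass_zero]; exact ((sqClass_eq_one_iff one_ne_zero).mpr ⟨1, by norm_num⟩).symm⟩
  have gm1 : sqClass (-1 : ℚ) ∈ Set.range W.xSqClass := by
    have h := sqClass_mem_range_of_eq (b := -6497) (x := -16) (y := 316) (by norm_num) (by norm_num)
    rwa [show (-16 : ℚ) = -1 * 4 ^ 2 by norm_num, sqClass_mul_sq' (by norm_num) (by norm_num)] at h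
  have g89 : sqClass (89 : ℚ) ∈ Set.range W.xSqClass :=
    sqClass_mem_range_of_eq (b := -6497) (x := 89) (y := 356) (by norm_num) (by norm_num)
  have gm73 : sqClass (-73 : ℚ) ∈ Set.range W.xSqClass :=
    sqClass_mem_range_of_eq (b := -6497) (x := -73) (y := 292) (by norm_num) (by norm_num)
  have g73 : sqClass (73 : ℚ) ∈ Set.range W.xSqClass := by
    have h := mul (by norm_num) (by norm_num) gm1 gm73; norm_num at h; exact h
  have gm89 : sqClass (-89 : ℚ) ∈ Set.range W.xSqClass := by
    have h := mul (by norm_num) (by norm_num) gm1 g89; norm_num at h; exact h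
  set C : Finset ℤ := {1, -1, 73, -73, 89, -89} with hC
  have hsqf : ∀ d ∈ C, Squarefree d := by
    intro d hd
    simp only [hC, Finset.mem_insert, Finset.mem_singleton] at hd
    rcases hd with rfl | rfl | rfl | rfl | rfl | rfl
    · exact squarefree_int_of_natAbs (n := 1) rfl one_ne_zero (by simp)
    · exact squarefree_int_of_natAbs (n := 1) rfl one_ne_zero (by simp)
    · exact squarefree_int_of_natAbs (n := 73) rfl (by norm_num) (by simp)
    · exact squarefree_int_of_natAbs (n := 73) rfl (by norm_num) (by simp)
    · exact squarefree_int_of_natAbs (n := 89) rfl (by norm_num) (by simp)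
    · exact squarefree_int_of_natAbs (n := 89) rfl (by norm_num) (by simp)
  have hsub : (↑(C.image fun d : ℤ => sqClass (d : ℚ)) : Set (SqUnits ℚ)) ⊆ Set.range W.xSqClass := by
    intro c hc
    obtain ⟨d, hd, rfl⟩ := Finset.mem_image.mp (Finset.mem_coe.mp hc)
    simp only [hC, Finset.mem_insert, Finset.mem_singleton] at hd
    rcases hd with rfl | rfl | rfl | rfl | rfl | rfl <;> push_cast
    · exact g0
    · exact gm1
    · exact g73
    · exact gm73
    · exact g89
    · exact gm89
  have hcard : (C.image fun d : ℤ => sqClass (d : ℚ)).card = 6 := by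
    rw [Finset.card_image_of_injOn (fun d₁ h₁ d₂ h₂ he => eq_of_sqClass_intCast_eq (hsqf d₁ h₁) (hsqf d₂ h₂) he)]
    rfl
  calc 6 = (↑(C.image fun d : ℤ => sqClass (d : ℚ)) : Set (SqUnits ℚ)).ncard := by rw [Set.ncard_coe_finset, hcard]
    _ ≤ (Set.range W.xSqClass).ncard := Set.ncard_le_ncard hsub hfin
    _ = Nat.card (Set.range W.xSqClass) := (Nat.card_coe_set_eq _).symm

/-- **`#ᾱ(E'(ℚ)) ≥ 5` for `E' : y² = x³ + 25988x`**: the points `(2, 228)`, `(146, 2628)`, `(178, 3204)` give `ᾱ = [2], [146],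
[178]`, whence also `[73] = [2·146]` and `[1]`. UNCONDITIONAL. [cite: SilvermanTate2015, §3.5–3.6 (ᾱ on Γ̄)] -/
theorem natCard_range_xSqClass_E'_ge :
    (Set.range (⟨0, 0, 0, 25988, 0⟩ : WeierstrassCurve ℚ).xSqClass).Finite ∧
      5 ≤ Nat.card (Set.range (⟨0, 0, 0, 25988, 0⟩ : WeierstrassCurve ℚ).xSqClass) := by
  haveI := isElliptic_E'
  set W := (⟨0, 0, 0, 25988, 0⟩ : WeierstrassCurve ℚ) with hW
  have hfin : (Set.range W.xSqClass).Finite := by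
    have h := (natCard_range_xSqClass_le (a := -2 * 0) (b := (0 : ℤ) ^ 2 - 4 * (-6497))
      (twoIsogenyCodomain_ne_zero hab4)).1
    rw [lit_E'] at h
    exact h
  refine ⟨hfin, ?_⟩
  have mul : ∀ {x y : ℚ}, x ≠ 0 → y ≠ 0 → sqClass x ∈ Set.range W.xSqClass → sqClass y ∈ Set.range W.xSqClass →
      sqClass (x * y) ∈ Set.range W.xSqClass := by
    intro x y hx hy h₁ h₂
    rw [sqClass_mul hx hy]
    exact mul_mem_range_xSqClass W h₁ h₂
  have g0 : sqClass (1 : ℚ) ∈ Set.range W.xSqClass :=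
    ⟨0, by rw [xSqClass_zero]; exact ((sqClass_eq_one_iff one_ne_zero).mpr ⟨1, by norm_num⟩).symm⟩
  have g2 : sqClass (2 : ℚ) ∈ Set.range W.xSqClass :=
    sqClass_mem_range_of_eq (b := 25988) (x := 2) (y := 228) (by norm_num) (by norm_num)
  have g146 : sqClass (146 : ℚ) ∈ Set.range W.xSqClass :=
    sqClass_mem_range_of_eq (b := 25988) (x := 146) (y := 2628) (by norm_num) (by norm_num)
  have g178 : sqClass (178 : ℚ) ∈ Set.range W.xSqClass :=
    sqClass_mem_range_of_eq (b := 25988) (x := 178) (y := 3204) (by norm_num) (by norm_num)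
  have g73 : sqClass (73 : ℚ) ∈ Set.range W.xSqClass := by
    have h := mul (by norm_num) (by norm_num) g2 g146
    rwa [show (2 : ℚ) * 146 = 73 * 2 ^ 2 by norm_num, sqClass_mul_sq' (by norm_num) two_ne_zero] at h
  set C : Finset ℤ := {1, 2, 73, 146, 178} with hC
  have hsqf : ∀ d ∈ C, Squarefree d := by
    intro d hd
    simp only [hC, Finset.mem_insert, Finset.mem_singleton] at hd
    rcases hd with rfl | rfl | rfl | rfl | rfl
    · exact squarefree_int_of_natAbs (n := 1) rfl one_ne_zero (by simp)
    · exact squarefree_int_of_natAbs (n := 2) rfl two_ne_zero (by simp)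
    · exact squarefree_int_of_natAbs (n := 73) rfl (by norm_num) (by simp)
    · exact squarefree_int_of_natAbs (n := 146) rfl (by norm_num) (by simp)
    · exact squarefree_int_of_natAbs (n := 178) rfl (by norm_num) (by simp)
  have hsub : (↑(C.image fun d : ℤ => sqClass (d : ℚ)) : Set (SqUnits ℚ)) ⊆ Set.range W.xSqClass := by
    intro c hc
    obtain ⟨d, hd, rfl⟩ := Finset.mem_image.mp (Finset.mem_coe.mp hc)
    simp only [hC, Finset.mem_insert, Finset.mem_singleton] at hd
    rcases hd with rfl | rfl | rfl | rfl | rfl <;> push_cast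
    · exact g0
    · exact g2
    · exact g73
    · exact g146
    · exact g178
  have hcard : (C.image fun d : ℤ => sqClass (d : ℚ)).card = 5 := by
    rw [Finset.card_image_of_injOn (fun d₁ h₁ d₂ h₂ he => eq_of_sqClass_intCast_eq (hsqf d₁ h₁) (hsqf d₂ h₂) he)]
    rfl
  calc 5 = (↑(C.image fun d : ℤ => sqClass (d : ℚ)) : Set (SqUnits ℚ)).ncard := by rw [Set.ncard_coe_finset, hcard]
    _ ≤ (Set.range W.xSqClass).ncard := Set.ncard_le_ncard hsub hfin
    _ = Nat.card (Set.range W.xSqClass) := (Nat.card_coe_set_eq _).symm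

/-! ## §2 `rank E(ℚ) = 4`, `Ш(E/ℚ)[2] = 0`, `t_2(E) = 0`, `corank Sel_{2^∞}(E/ℚ) = 4` -/

/-- `ν(6497) = 2`, `ν(12994) = 3` (`6497 = 73·89`): the bound `ν(D) + ν(2D) − 1` of the descent is `4`. [folklore] -/
theorem card_primeFactors_n :
    (-6497 : ℤ).natAbs.primeFactors.card = 2 ∧ (2 * (-6497 : ℤ)).natAbs.primeFactors.card = 3 := by
  rw [show (-6497 : ℤ).natAbs = 6497 from rfl, show (2 * (-6497 : ℤ)).natAbs = 12994 from rfl]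
  constructor <;> simp [Nat.primeFactors]

/-- **`rank E(ℚ) = 4` for `E : y² = x³ − 6497x`**, UNCONDITIONALLY: `#α · #ᾱ = 2^{rank+2}` with both factors powers of `2`,
`#α ≥ 6 ⇒ #α ≥ 8`, `#ᾱ ≥ 5 ⇒ #ᾱ ≥ 8`, so `2^{rank+2} ≥ 2⁶`; and `rank ≤ ν(6497) + ν(12994) − 1 = 4`.
[cite: SilvermanTate2015, §3.6 (2^r = #α(Γ)·#ᾱ(Γ̄)/4)] [cite: SilvermanAEC2009, Prop. X.6.1(b)] -/
theorem mordellWeilRank_eq_four : (⟨0, 0, 0, -6497, 0⟩ : WeierstrassCurve ℚ).mordellWeilRank = 4 := by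
  haveI hE := isElliptic_mk_of_ne_zero (F := ℚ) hab4
  have key := natCard_range_xSqClass_mul (⟨0, ((0 : ℤ) : ℚ), 0, ((-6497 : ℤ) : ℚ), 0⟩ : WeierstrassCurve ℚ)
  rw [twoIsogenyCodomain_mk_intCast 0 (-6497 : ℤ), lit_E', lit_E] at key
  obtain ⟨-, h6⟩ := natCard_range_xSqClass_E_ge
  obtain ⟨-, h5⟩ := natCard_range_xSqClass_E'_ge
  set A := Nat.card (Set.range (⟨0, 0, 0, -6497, 0⟩ : WeierstrassCurve ℚ).xSqClass) with hA
  set A' := Nat.card (Set.range (⟨0, 0, 0, 25988, 0⟩ : WeierstrassCurve ℚ).xSqClass) with hA'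
  set r := (⟨0, 0, 0, -6497, 0⟩ : WeierstrassCurve ℚ).mordellWeilRank with hr
  obtain ⟨j, -, hj⟩ := (Nat.dvd_prime_pow Nat.prime_two).mp (Dvd.intro _ key : A ∣ 2 ^ (r + 2))
  obtain ⟨j', -, hj'⟩ := (Nat.dvd_prime_pow Nat.prime_two).mp (Dvd.intro_left _ key : A' ∣ 2 ^ (r + 2))
  have h8 : 8 ≤ A := eight_le_of_pow hj (by omega)
  have h8' : 8 ≤ A' := eight_le_of_pow hj' (by omega)
  have h64 : 2 ^ 6 ≤ 2 ^ (r + 2) := by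
    rw [← key]
    exact le_trans (by norm_num) (Nat.mul_le_mul h8 h8')
  have hge : 6 ≤ r + 2 := (Nat.pow_le_pow_iff_right Nat.one_lt_two).mp h64
  have hle := XCubeAddDX.mordellWeilRank_le_add (D := -6497) (by norm_num)
  rw [card_primeFactors_n.1, card_primeFactors_n.2, lit_E₀] at hle
  omega

/-- `rank E(ℚ) = ν(D) + ν(2D) − 1` for `D = −6497`: the descent bound is attained. [cite: SilvermanAEC2009, Prop. X.6.1(b)] -/
theorem mordellWeilRank_eq_bound :
    (⟨0, 0, 0, ((-6497 : ℤ) : ℚ), 0⟩ : WeierstrassCurve ℚ).mordellWeilRank =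
      (-6497 : ℤ).natAbs.primeFactors.card + (2 * (-6497 : ℤ)).natAbs.primeFactors.card - 1 := by
  rw [lit_E₀, mordellWeilRank_eq_four, card_primeFactors_n.1, card_primeFactors_n.2]

/-- **`Ш(E/ℚ)[2] = 0` for `E : y² = x³ − 6497x`**, UNCONDITIONALLY (sharp descent, tree
`forall_mem_sha_two_smul_eq_zero_xD_of_rank_eq`). [cite: SilvermanAEC2009, Prop. X.4.7 and Thm. X.4.2(a)] -/
theorem forall_mem_sha_two_smul_eq_zero :
    ∀ c ∈ (⟨0, 0, 0, -6497, 0⟩ : WeierstrassCurve ℚ).sha, 2 • c = 0 → c = 0 := by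
  have h := forall_mem_sha_two_smul_eq_zero_xD_of_rank_eq (D := -6497) (by norm_num) mordellWeilRank_eq_bound
  rwa [lit_E₀] at h

/-- **The door at 2 at rank 4: `rank E(ℚ) = 4` and `t_2(E) = 0`** for `E : y² = x³ − 6497x`. UNCONDITIONAL.
[cite: SilvermanAEC2009, Prop. X.6.1(b) with Prop. X.4.7] [cite: Greenberg1999LNM, §1] -/
theorem door_at_two_rank_four :
    (⟨0, 0, 0, -6497, 0⟩ : WeierstrassCurve ℚ).mordellWeilRank = 4 ∧ (⟨0, 0, 0, -6497, 0⟩ : WeierstrassCurve ℚ).shaCorank 2 = 0 := by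
  have h := shaCorank_two_xD_of_rank_eq (D := -6497) (by norm_num) mordellWeilRank_eq_bound
  rw [lit_E₀] at h
  exact ⟨mordellWeilRank_eq_four, h⟩

/-- **`corank_{ℤ_2} Sel_{2^∞}(E/ℚ) = 4 = rank E(ℚ)`** for `E : y² = x³ − 6497x`. UNCONDITIONAL. [cite: Greenberg1999LNM, §1 pp. 54–57] -/
theorem selmerCorank_two_eq_four : (⟨0, 0, 0, -6497, 0⟩ : WeierstrassCurve ℚ).selmerCorank 2 = 4 := by
  have h := selmerCorank_two_xD_of_rank_eq (D := -6497) (by norm_num) mordellWeilRank_eq_bound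
  rw [lit_E₀, mordellWeilRank_eq_four] at h
  exact h

/-- **O holds for `E : y² = x³ − 6497x`** (rank 4), witness `p₀ = 2`. UNCONDITIONAL. [cite: Greenberg1999LNM, §1] -/
theorem oneFiniteShaComponent_E :
    ∃ (q : ℕ) (_ : Fact q.Prime), (⟨0, 0, 0, -6497, 0⟩ : WeierstrassCurve ℚ).shaCorank q = 0 :=
  ⟨2, ⟨Nat.prime_two⟩, door_at_two_rank_four.2⟩

/-- **T at the rank-4 door** (the crux BY NAME): granting T, `t_q(E) = 0` and `corank_{ℤ_q} Sel_{q^∞}(E/ℚ) = 4` at every prime `q`.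
[cite: Greenberg1999LNM, §1 pp. 54–57] -/
theorem selmerCorank_eq_four_of_transfer (hT : FiniteShaComponentTransfer) (q : ℕ) [Fact q.Prime] :
    (⟨0, 0, 0, -6497, 0⟩ : WeierstrassCurve ℚ).shaCorank q = 0 ∧ (⟨0, 0, 0, -6497, 0⟩ : WeierstrassCurve ℚ).selmerCorank q = 4 := by
  haveI := isElliptic_E
  haveI : Fact (Nat.Prime 2) := ⟨Nat.prime_two⟩
  have h0 : (⟨0, 0, 0, -6497, 0⟩ : WeierstrassCurve ℚ).shaCorank q = 0 := hT _ 2 q door_at_two_rank_four.2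
  refine ⟨h0, ?_⟩
  rw [(⟨0, 0, 0, -6497, 0⟩ : WeierstrassCurve ℚ).selmerCorank_eq_mordellWeilRank_add_holds q, mordellWeilRank_eq_four, h0]

/-- **T's hypothesis is kernel-certified at rank 4**: an elliptic `E/ℚ` with `rank = 4`, `corank Sel_{2^∞}(E) = 4`, `t_2(E) = 0`.
UNCONDITIONAL. [cite: Greenberg1999LNM, §1] -/
theorem exists_transfer_hypothesis_rank_four :
    ∃ W : WeierstrassCurve ℚ, W.IsElliptic ∧ W.mordellWeilRank = 4 ∧ W.selmerCorank 2 = 4 ∧ W.shaCorank 2 = 0 :=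
  ⟨_, isElliptic_E, mordellWeilRank_eq_four, selmerCorank_two_eq_four, door_at_two_rank_four.2⟩

end Summit.BirchSwinnertonDyer.BirchSwinnertonDyer.Theorems.ShaPrimaryTransferKernelRankFour

end
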